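import Mathlib.Analysis.InnerProductSpace.l2Space
import Summits.RiemannHypothesis.RiemannHypothesis.Theses.SpectralTrace
import Summits.RiemannHypothesis.RiemannHypothesis.Theorems.WindowTraceArch.Negative.LocalWeyl
import Literature.Analysis.UnboundedOperators.TraceFormula

/-!
# RiemannHypothesis / SpectralTrace — the support item `SpectralPackaging` (operator packaging of X)

Route `RiemannHypothesis/SpectralTrace`, item stmt-RiemannHypothesis-11199 (`SpectralPackaging`,
support, rank 9):

  `X → ∃ (H : Type) [NormedAddCommGroup H] [InnerProductSpace ℂ H] [CompleteSpace H]
      (D : H →ₗ.[ℂ] H), D.SelfAdjointTraceFormula weilFunctional`,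

where `X` (the route's thesis `SpectralThesis`) says that some real family `γ : ι → ℝ`
reproduces the Weil functional: for every Weil test `g`,
`HasSum (fun i => weilMellin g (1/2 + iγ_i)) (weilFunctional g)`.

Proof (the honest Hilbert–Pólya packaging of a trace identity, Connes 1999 §III; Berry–Keating
1999 §1): take `H = ℓ²(ι, ℂ)` with its tautological Hilbert basis `b` (`b.repr = refl`) and the
maximal diagonal operator `D = b.diagonalPMap (γ ·)` with real symbol `γ`; the constructor
`HilbertBasis.selfAdjointTraceFormula_diagonalPMap` reduces the claim to the eigenvalue identity
(which is `X` itself) and to LOCAL FINITENESS of the spectrum, `{i | |γ i| ≤ K}` finite for every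
`K` (compact resolvent). The latter is the in-tree local Weyl law for window-trace families,
`WindowTraceArch.Negative.finite_abs_le_of_windowTrace` (test the identity against the modulated
autocorrelation `h_T ⋆ h̃_T` of a narrow bump: every point of the family in `[T-1, T+1]` costs a
fixed `c > 0` of the non-negative convergent sum `Σ_i |ĥ_T(1/2+iγ_i)|² = W(h_T ⋆ h̃_T)`), applied
with the window `[-1, 1]` — a family reproducing `W` on all Weil tests does so in particular on
those supported in `[-1, 1]`.

References: A. Connes, Selecta Math. 5 (1999) 29–106, §III; R. Meyer, Duke Math. J. 127 (2005)
519–595; M. V. Berry, J. P. Keating, SIAM Review 41 (1999) 236–266, §1.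
-/

noncomputable section

-- D-0017: single-problem summit ⇒ namespace `Summit.RiemannHypothesis.RiemannHypothesis.…` by design
-- (the Summits library sets `weak.linter.dupNamespace = false`; repeated here for standalone checks).
set_option linter.dupNamespace false

namespace Summit.RiemannHypothesis.RiemannHypothesis.Theorems

open Summit.RiemannHypothesis.RiemannHypothesis.Theses.SpectralTrace
open Literature.NumberTheory.LFunctions Complex
open scoped lp

/-- **Local finiteness of a spectral realisation of the Weil functional.** If a real family
`γ : ι → ℝ` reproduces the Weil functional on every Weil test
(`HasSum (fun i => weilMellin g (1/2 + iγ_i)) (weilFunctional g)`), then `{i | |γ i| ≤ K}` is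
finite for every `K` — the window-free special case of the local Weyl law
`WindowTraceArch.Negative.finite_abs_le_of_windowTrace` (window `[-1, 1]`). [folklore] -/
theorem finite_abs_le_of_spectralTrace {ι : Type*} {γ : ι → ℝ}
    (h : ∀ g : ℝ → ℂ, IsWeilTest g →
      HasSum (fun i => weilMellin g (1 / 2 + (γ i : ℂ) * I)) (weilFunctional g)) (K : ℝ) :
    {i : ι | |γ i| ≤ K}.Finite :=
  WindowTraceArch.Negative.finite_abs_le_of_windowTrace one_pos (fun g hg _ => h g hg) K

/-- **Diagonal packaging on `ℓ²(ι, ℂ)`.** A real family `γ : ι → ℝ` reproducing the Weil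
functional on every Weil test is the spectrum (with multiplicity) of a self-adjoint operator
with compact resolvent satisfying the trace formula `Tr ĝ(D) = W(g)`: the maximal diagonal
operator with symbol `γ` in the tautological Hilbert basis of `ℓ²(ι, ℂ)`
(`HilbertBasis.selfAdjointTraceFormula_diagonalPMap` + `finite_abs_le_of_spectralTrace`).
[Connes 1999, §III] [folklore] -/
theorem selfAdjointTraceFormula_diagonalPMap_lp {ι : Type} {γ : ι → ℝ}
    (h : ∀ g : ℝ → ℂ, IsWeilTest g →
      HasSum (fun i => weilMellin g (1 / 2 + (γ i : ℂ) * I)) (weilFunctional g)) :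
    ((⟨LinearIsometryEquiv.refl ℂ (ℓ²(ι, ℂ))⟩ : HilbertBasis ι ℂ (ℓ²(ι, ℂ))).diagonalPMap
        fun i => (γ i : ℂ)).SelfAdjointTraceFormula weilFunctional :=
  HilbertBasis.selfAdjointTraceFormula_diagonalPMap _ γ (finite_abs_le_of_spectralTrace h) h

/-- **Item `SpectralPackaging` (stmt-RiemannHypothesis-11199, route SpectralTrace, support):**
the route thesis `X` (a real family `γ` with `Σ_i ĝ(1/2 + iγ_i) = W(g)` as a `HasSum` for every
Weil test `g`) yields a complex Hilbert space `H` and an operator `D : H →ₗ.[ℂ] H` with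
`D.SelfAdjointTraceFormula weilFunctional` — namely `H = ℓ²(ι, ℂ)` and the diagonal operator with
symbol `γ` (`selfAdjointTraceFormula_diagonalPMap_lp`); local finiteness of the spectrum comes
from the local Weyl law of window-trace families. [Connes 1999, §III; Berry–Keating 1999, §1]
[folklore] -/
theorem spectralPackaging_proof : SpectralPackaging := by
  unfold SpectralPackaging
  rintro ⟨ι, γ, hX⟩
  exact ⟨ℓ²(ι, ℂ), inferInstance, inferInstance, inferInstance, _,
    selfAdjointTraceFormula_diagonalPMap_lp hX⟩

end Summit.RiemannHypothesis.RiemannHypothesis.Theorems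

end
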